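import Mathlib
import Summits.Ventures.PercRepro2.MixChordLaw

/-!
# The crux from the `o`-class `D`-law and the existential (MIX²) row on the instances without an
`o`-class root edge (blind cell PercRepro2, night-1 g20; proofs/NIGHT1-G20.md §6–§7)

The exhaustive atlas census (n ≤ 7) refutes every «for every root edge» row with a fixed polynomial
normaliser along the `b`- and `u`-class root edges (`MixChordNoWitness_all`, `MixChord2NoWitness_all`
are FALSE: doubled near-deterministic `b`-edges), while the `o`-class `D`-law never failed
(0 / 5,576,070).  The honest rows of record are therefore the `o`-class `D`-law (`DLawO_all`) and the
EXISTENTIAL (MIX²) row on the instances with NO `o`-class root edge (**`MixChord2ExistsNoO_all`**):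

* **`step_of_dLaw_of_exists`**: the inductive step at `p` from `NLaw D` along the `o`-class root
  edges and the existential (MIX²) row when `p` has no `o`-class root edge;
* **`HCov_all_of_dLawO_of_exists`**: the crux from `DLawO_all` and `MixChord2ExistsNoO_all`.

Own code; standard axioms.
-/

namespace Summit.Ventures.PercRepro2

open UnionCluster CovForm

namespace Mix

open scoped Classical

section Exists

variable {V : Type*} {E : Type*} [Fintype E] [DecidableEq E] [Fintype V] [DecidableEq V]
  {R : Type*} [Field R] [LinearOrder R] [IsStrictOrderedRing R]

omit [Fintype V] [DecidableEq V] in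
/-- **The inductive step at `p`** from the `D`-law along the `o`-class root edges and, when `p` has
no `o`-class root edge, some root edge satisfying (MIX²) (the `(D·Z)²`-chord). -/
theorem step_of_dLaw_of_exists {p : E → R} {ends : E → Sym2 V} {o a₁ a₂ a₃ b : V} (hp : IsProbVec p)
    (hO : ∀ e ∈ Chord.rootEdges p ends a₁ a₂, OClass p ends o a₁ a₂ e →
      NLaw (normD ends a₁ a₂ a₃) p ends o a₁ a₂ a₃ b e)
    (hE : (∀ e ∈ Chord.rootEdges p ends a₁ a₂, ¬ OClass p ends o a₁ a₂ e) →
      (Chord.rootEdges p ends a₁ a₂).Nonempty → ∃ e ∈ Chord.rootEdges p ends a₁ a₂,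
        p e * Gc (Function.update p e 1) ends o a₁ a₂ a₃ b +
          (1 - p e) * (shrink p ends a₁ a₂ a₃ e ^ 2 * Gc (Function.update p e 0) ends o a₁ a₂ a₃ b) ≤
            Gc p ends o a₁ a₂ a₃ b) :
    InductiveStep p ends o a₁ a₂ a₃ b := by
  intro hne
  by_cases hO' : ∃ e ∈ Chord.rootEdges p ends a₁ a₂, OClass p ends o a₁ a₂ e
  · obtain ⟨e, he, hc⟩ := hO'
    exact ⟨e, he, fun h1 h0 => Gc_nonneg_of_nMixChord_D hp (nMixChord_of_nLaw hp (hO e he hc)) h1 h0⟩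
  · have hno : ∀ e ∈ Chord.rootEdges p ends a₁ a₂, ¬ OClass p ends o a₁ a₂ e :=
      fun e he hc => hO' ⟨e, he, hc⟩
    obtain ⟨e, he, hle⟩ := hE hno hne
    refine ⟨e, he, fun h1 h0 => ?_⟩
    exact (add_nonneg (mul_nonneg (hp.nonneg e) h1)
      (mul_nonneg (sub_nonneg.2 (hp.le_one e))
        (mul_nonneg (pow_nonneg (shrink_nonneg hp ends a₁ a₂ a₃ e) 2) h0))).trans hle

end Exists

section ExistsAll

variable (R : Type*) [Field R] [LinearOrder R] [IsStrictOrderedRing R]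

/-- **Row (MIX²-∃ off the `o`-class)**: at every instance with a fractional root edge but no
`o`-class root edge, some root edge satisfies the `(D·Z)²`-chord. -/
def MixChord2ExistsNoO_all : Prop :=
  ∀ (V E : Type) [Fintype V] [DecidableEq V] [Fintype E] [DecidableEq E]
    (ends : E → Sym2 V) (p : E → R), IsProbVec p →
    ∀ o a₁ a₂ a₃ b : V, a₁ ≠ a₂ → a₁ ≠ a₃ → a₂ ≠ a₃ → o ≠ a₁ → o ≠ a₂ → o ≠ a₃ → o ≠ b →
      b ≠ a₁ → b ≠ a₂ → b ≠ a₃ →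
      (∀ e ∈ Chord.rootEdges p ends a₁ a₂, ¬ OClass p ends o a₁ a₂ e) →
      (Chord.rootEdges p ends a₁ a₂).Nonempty → ∃ e ∈ Chord.rootEdges p ends a₁ a₂,
        p e * Gc (Function.update p e 1) ends o a₁ a₂ a₃ b +
          (1 - p e) * (shrink p ends a₁ a₂ a₃ e ^ 2 * Gc (Function.update p e 0) ends o a₁ a₂ a₃ b) ≤
            Gc p ends o a₁ a₂ a₃ b

/-- **The crux from the `o`-class `D`-law and the existential (MIX²) row off the `o`-class.** -/
theorem HCov_all_of_dLawO_of_exists (h₁ : DLawO_all R) (h₂ : MixChord2ExistsNoO_all R) :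
    HCov_all R :=
  HCov_all_of_inductiveStep_all R fun V E _ _ _ _ ends p hp o a₁ a₂ a₃ b h12 h13 h23 ho1 ho2 ho3
    hob hb1 hb2 hb3 =>
      step_of_dLaw_of_exists hp
        (h₁ V E ends p hp o a₁ a₂ a₃ b h12 h13 h23 ho1 ho2 ho3 hob hb1 hb2 hb3)
        (h₂ V E ends p hp o a₁ a₂ a₃ b h12 h13 h23 ho1 ho2 ho3 hob hb1 hb2 hb3)

end ExistsAll

end Mix

end Summit.Ventures.PercRepro2
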